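import Literature.Computability.AlgebraicComplexity.FlipGraphConnectivity
import HarnessLib

/-!
# Triangles and squares in the flip graph (KM 2023, §4)

Topic `Literature/Computability/AlgebraicComplexity`; companion of `FlipGraphConnectivity.lean` (KM
Def. 4 as the relations `FlipBase` / `Flips` on multisets of tensors). Source: M. Kauers, J. Moosbauer,
*Flip Graphs for Matrix Multiplication*, ISSAC 2023 = arXiv:2212.01175 (KM), §4 (the `(3,3,3)`-flip
graph over `ℤ₂`, discussion of Fig. 3): "The triangular structure in this component appears often in
the flip graph. It originates from the two possibilities to choose `T` for a flip. Two flips of a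
scheme that use the same rank-one tensors in the flip always are adjacent. The square structure in the
middle appears whenever there is an element that shares a different factor with each of two other
elements of a scheme." Everything here is PROVED; no named facts.

* `kauersMoosbauer2023_two_flips_adjacent` — **triangles**: over a ground ring of characteristic `2`
  (KM §4: `K = ℤ₂`), the two flips `S'`, `S''` of `S` at the same pair `A⊗B⊗Γ, A⊗B'⊗Γ'` (the two
  choices `T = A⊗B⊗Γ'` and `T = A⊗B'⊗Γ` of Def. 4) are flips of each other. (In characteristic `≠ 2`
  the flip of `S'` along the new pair is `{A⊗B'⊗(Γ+Γ'), A⊗(B−B')⊗Γ}`, which differs from `S''` by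
  signs; the hypothesis `2 = 0` is necessary.)
* `kauersMoosbauer2023_square` — **squares**: if `T₀ = A⊗B⊗Γ` shares its first factor with
  `T₁ = A⊗B₁⊗Γ₁` and its second factor with `T₂ = A₂⊗B⊗Γ₂`, then the flip of `S` at `(T₀,T₁)` and the
  flip at `(T₀,T₂)` (each modifying the third factor of `T₀`) commute: the two results have a common
  flip neighbour, giving a `4`-cycle `S — S₁ — S₁₂ — S₂ — S` (any ground ring).

## References

* M. Kauers, J. Moosbauer, *Flip Graphs for Matrix Multiplication*, ISSAC 2023, 381–388,
  doi:10.1145/3597066.3597120, arXiv:2212.01175, §4 (discussion of Fig. 3), Def. 4.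
  [KauersMoosbauer2022FlipGraphs]
-/

namespace Literature.Computability.AlgebraicComplexity

open scoped BigOperators
open Multiset

namespace FlipGraph

variable {K : Type*} [CommRing K] {ι κ μ : Type*}

/-- `a⊗b⊗c + a⊗b⊗c' = a⊗b⊗(c+c')`. [folklore] -/
private theorem triad_add_thd (a : ι → K) (b : κ → K) (c c' : μ → K) :
    triad a b c + triad a b c' = triad a b (c + c') := by
  funext x y z; simp only [Pi.add_apply, triad_apply]; ring

/-- `a⊗b'⊗c − a⊗b⊗c = a⊗(b'−b)⊗c`. [folklore] -/
private theorem triad_sub_snd (a : ι → K) (b b' : κ → K) (c : μ → K) :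
    triad a b' c - triad a b c = triad a (b' - b) c := by
  funext x y z; simp only [Pi.sub_apply, triad_apply]; ring

/-- `a⊗b⊗c + a⊗b'⊗c = a⊗(b+b')⊗c`. [folklore] -/
private theorem triad_add_snd (a : ι → K) (b b' : κ → K) (c : μ → K) :
    triad a b c + triad a b' c = triad a (b + b') c := by
  funext x y z; simp only [Pi.add_apply, triad_apply]; ring

/-- `a⊗b⊗c' − a⊗b⊗c = a⊗b⊗(c'−c)`. [folklore] -/
private theorem triad_sub_thd (a : ι → K) (b : κ → K) (c c' : μ → K) :
    triad a b c' - triad a b c = triad a b (c' - c) := by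
  funext x y z; simp only [Pi.sub_apply, triad_apply]; ring

/-- `sw₁₂ (a⊗b⊗c) = b⊗a⊗c`. [folklore] -/
private theorem sw₁₂_triad' (a : ι → K) (b : κ → K) (c : μ → K) :
    sw₁₂ (triad a b c) = triad b a c := by
  funext x y z; simp only [sw₁₂, triad_apply]; ring

/-! ## Triangles: the two flips at one pair are adjacent (characteristic `2`) -/

/-- **KM §4: "Two flips of a scheme that use the same rank-one tensors in the flip always are
adjacent."** Over a ring with `2 = 0` (KM: `K = ℤ₂`): let `S ∋ A⊗B⊗Γ, A⊗B'⊗Γ'` and let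
`S' = (S ∖ {T₁,T₂}) ∪ {A⊗B⊗(Γ+Γ'), A⊗(B'−B)⊗Γ'}` (choice `T = A⊗B⊗Γ'`) and
`S'' = (S ∖ {T₁,T₂}) ∪ {A⊗(B+B')⊗Γ, A⊗B'⊗(Γ'−Γ)}` (choice `T = A⊗B'⊗Γ`) be its two flips at this pair
(Def. 4). Then `S''` is a flip of `S'` (at the new pair, with `T = A⊗(B'−B)⊗(Γ+Γ')`) — the "triangular
structure" `S, S', S''`. [cite: KauersMoosbauer2022FlipGraphs, §4 (discussion of Fig. 3) with Def. 4] -/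
theorem kauersMoosbauer2023_two_flips_adjacent (h2 : (2 : K) = 0) (a : ι → K) (b b' : κ → K)
    (c c' : μ → K) (R : Multiset (ι → κ → μ → K)) :
    FlipBase ((triad a b c + triad a b c') ::ₘ (triad a b' c' - triad a b c') ::ₘ R)
      ((triad a b c + triad a b' c) ::ₘ (triad a b' c' - triad a b' c) ::ₘ R) := by
  refine ⟨a, b, b' - b, c + c', c', R, ?_, Or.inr ?_⟩
  · rw [triad_add_thd, triad_sub_snd]
  · -- `S'' = (X + T) ::ₘ (Y − T) ::ₘ R` with `X = A⊗B⊗(Γ+Γ')`, `Y = A⊗(B'−B)⊗Γ'`,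
    -- `T = A⊗(B'−B)⊗(Γ+Γ')`, up to the order of the two new elements
    rw [triad_add_snd, triad_sub_thd, Multiset.cons_swap]
    congr 1
    · -- `A⊗B'⊗(Γ'−Γ) = A⊗B⊗(Γ+Γ') + A⊗(B'−B)⊗(Γ+Γ')` in characteristic 2
      funext x y z
      simp only [Pi.add_apply, Pi.sub_apply, triad_apply]
      linear_combination (-(a x * b' y * c z)) * h2
    · congr 1
      -- `A⊗(B+B')⊗Γ = A⊗(B'−B)⊗Γ' − A⊗(B'−B)⊗(Γ+Γ')` in characteristic 2
      funext x y z
      simp only [Pi.add_apply, Pi.sub_apply, triad_apply]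
      linear_combination (a x * b' y * c z) * h2

/-- Hence (symmetric form): the two flips at one pair are flips of each other in both directions.
[cite: KauersMoosbauer2022FlipGraphs, §4 (discussion of Fig. 3), §3 ("flips are reversible")] -/
theorem kauersMoosbauer2023_two_flips_adjacent' (h2 : (2 : K) = 0) (a : ι → K) (b b' : κ → K)
    (c c' : μ → K) (R : Multiset (ι → κ → μ → K)) :
    Flips ((triad a b c + triad a b c') ::ₘ (triad a b' c' - triad a b c') ::ₘ R)
        ((triad a b c + triad a b' c) ::ₘ (triad a b' c' - triad a b' c) ::ₘ R) ∧
      Flips ((triad a b c + triad a b' c) ::ₘ (triad a b' c' - triad a b' c) ::ₘ R)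
        ((triad a b c + triad a b c') ::ₘ (triad a b' c' - triad a b c') ::ₘ R) :=
  ⟨Or.inl (kauersMoosbauer2023_two_flips_adjacent h2 a b b' c c' R),
    Flips.symm (Or.inl (kauersMoosbauer2023_two_flips_adjacent h2 a b b' c c' R))⟩

/-! ## Squares: flips at two pairs through one element commute -/

/-- **KM §4: "The square structure … appears whenever there is an element that shares a different
factor with each of two other elements of a scheme."** Let `S ∋ T₀ = A⊗B⊗Γ`, `T₁ = A⊗B₁⊗Γ₁` (sharing
the first factor with `T₀`) and `T₂ = A₂⊗B⊗Γ₂` (sharing the second). Flipping `S` at `(T₀,T₁)` with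
`T = A⊗B⊗Γ₁` gives `S₁ ∋ A⊗B⊗(Γ+Γ₁), A⊗(B₁−B)⊗Γ₁, T₂`; flipping at `(T₀,T₂)` with `T = A⊗B⊗Γ₂` gives
`S₂ ∋ A⊗B⊗(Γ+Γ₂), T₁, (A₂−A)⊗B⊗Γ₂`; and both `S₁` (at its pair sharing `B`) and `S₂` (at its pair
sharing `A`) flip to `S₁₂ ∋ A⊗B⊗(Γ+Γ₁+Γ₂), A⊗(B₁−B)⊗Γ₁, (A₂−A)⊗B⊗Γ₂` — a square `S, S₁, S₁₂, S₂` in the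
flip graph (any ground ring). [cite: KauersMoosbauer2022FlipGraphs, §4 (discussion of Fig. 3) with Def. 4] -/
theorem kauersMoosbauer2023_square (a a₂ : ι → K) (b b₁ : κ → K) (c c₁ c₂ : μ → K)
    (R : Multiset (ι → κ → μ → K)) :
    Flips (triad a b c ::ₘ triad a b₁ c₁ ::ₘ triad a₂ b c₂ ::ₘ R)
        (triad a b (c + c₁) ::ₘ triad a (b₁ - b) c₁ ::ₘ triad a₂ b c₂ ::ₘ R) ∧
      Flips (triad a b c ::ₘ triad a b₁ c₁ ::ₘ triad a₂ b c₂ ::ₘ R)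
        (triad a b (c + c₂) ::ₘ triad a b₁ c₁ ::ₘ triad (a₂ - a) b c₂ ::ₘ R) ∧
      Flips (triad a b (c + c₁) ::ₘ triad a (b₁ - b) c₁ ::ₘ triad a₂ b c₂ ::ₘ R)
        (triad a b (c + c₁ + c₂) ::ₘ triad a (b₁ - b) c₁ ::ₘ triad (a₂ - a) b c₂ ::ₘ R) ∧
      Flips (triad a b (c + c₂) ::ₘ triad a b₁ c₁ ::ₘ triad (a₂ - a) b c₂ ::ₘ R)
        (triad a b (c + c₁ + c₂) ::ₘ triad a (b₁ - b) c₁ ::ₘ triad (a₂ - a) b c₂ ::ₘ R) := by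
  refine ⟨?_, ?_, ?_, ?_⟩
  · -- `S → S₁`: shared first factor `A`, `T = A⊗B⊗Γ₁`
    refine Or.inl ⟨a, b, b₁, c, c₁, triad a₂ b c₂ ::ₘ R, rfl, Or.inl ?_⟩
    rw [triad_add_thd, triad_sub_snd]
  · -- `S → S₂`: shared second factor `B` (transport along `sw₁₂`), `T = A⊗B⊗Γ₂`
    refine Or.inr (Or.inl ⟨b, a, a₂, c, c₂, triad b₁ a c₁ ::ₘ R.map sw₁₂, ?_, Or.inl ?_⟩)
    · simp only [Multiset.map_cons, sw₁₂_triad']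
      rw [Multiset.cons_swap (triad b₁ a c₁)]
    · simp only [Multiset.map_cons, sw₁₂_triad']
      rw [triad_add_thd, triad_sub_snd, Multiset.cons_swap (triad b₁ a c₁)]
  · -- `S₁ → S₁₂`: shared second factor `B` between `A⊗B⊗(Γ+Γ₁)` and `A₂⊗B⊗Γ₂`, `T = A⊗B⊗Γ₂`
    refine Or.inr (Or.inl
      ⟨b, a, a₂, c + c₁, c₂, triad (b₁ - b) a c₁ ::ₘ R.map sw₁₂, ?_, Or.inl ?_⟩)
    · simp only [Multiset.map_cons, sw₁₂_triad']
      rw [Multiset.cons_swap (triad (b₁ - b) a c₁)]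
    · simp only [Multiset.map_cons, sw₁₂_triad']
      rw [triad_add_thd, triad_sub_snd, Multiset.cons_swap (triad (b₁ - b) a c₁)]
  · -- `S₂ → S₁₂`: shared first factor `A` between `A⊗B⊗(Γ+Γ₂)` and `A⊗B₁⊗Γ₁`, `T = A⊗B⊗Γ₁`
    refine Or.inl ⟨a, b, b₁, c + c₂, c₁, triad (a₂ - a) b c₂ ::ₘ R, rfl, Or.inl ?_⟩
    rw [triad_add_thd, triad_sub_snd, add_right_comm c c₂ c₁]

end FlipGraph

end Literature.Computability.AlgebraicComplexity
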